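import Mathlib.RingTheory.Ideal.Height
import Mathlib.RingTheory.Ideal.KrullsHeightTheorem
import Mathlib.RingTheory.Localization.AtPrime.Basic
import Mathlib.RingTheory.Spectrum.Prime.Basic
import Mathlib.RingTheory.MvPolynomial.Basic
import Literature.AlgebraicGeometry.Resolution.AffineDomainEquidim
import HarnessLib

/-!
# Local dimension of an affine hypersurface (crux `FInjectiveMacaulayfication`, line `Sketch`)

Support file for crux stmt-ResolutionOfSingularities-15315 (`FrobeniusLadder.FInjectiveMacaulayfication`,
line `Sketch`), stub `stub_hypersurfaceLocalDim` of the cycle-9 WEIGHTED CONE ENGINE (§15 of the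
registered skeleton 10f06f91): the dimension bookkeeping of the weighted blow-up charts, which are
hypersurfaces `k[X₀, …, Xₙ]/(g)` (and finite quotients of such), needs that EVERY local ring of an affine
hypersurface at a maximal ideal has dimension exactly `n` — `g ≠ 0` arbitrary, possibly reducible or
non-reduced, `k` any field.

* `height_le_of_height_comap_le` — for a domain `S`, `0 ≠ g ∈ S` and a prime `Q` of `S/(g)` whose
  pull-back `M = Q ∩ S` has height `≤ m + 1`, the height of `Q` is `≤ m`: a chain of primes of length `r`
  below `Q` pulls back to a chain of primes containing `g` below `M`, which the zero ideal extends by one.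
* `stub_hypersurfaceLocalDim` (registered signature) — for a field `k`, `0 ≠ g ∈ k[X₀, …, Xₙ]` and a
  maximal ideal `Q` of `k[X₀, …, Xₙ]/(g)`, `dim (k[X₀, …, Xₙ]/(g))_Q = n`.

Proof of the stub: `dim (S/(g))_Q = ht Q` (Mathlib `IsLocalization.AtPrime.ringKrullDim_eq_height`);
`M = Q ∩ S` is a maximal ideal of `S = k[X₀, …, Xₙ]` containing `g`, of height `n + 1` (tree theorem
`Literature.AlgebraicGeometry.Resolution.MvPolynomial.height_eq_of_isMaximal`, Matsumura §5 Ex. 5.1);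
`ht Q ≤ n` by `height_le_of_height_comap_le`; `ht Q ≥ n` by Krull's principal ideal theorem in the form
`ht M ≤ ht (M/(g)) + 1` (Mathlib `Ideal.height_le_height_add_one_of_mem`) and `M/(g) = Q`.
No definitions, no named facts.

## References

* H. Matsumura, *Commutative Ring Theory*, CUP 1986, §5 Ex. 5.1 (`ht P + coht P = n` in `k[X₁, …, Xₙ]`),
  §13 Thm. 13.5 (Krull's height theorem). [Matsumura1987]
* R. Hartshorne, *Algebraic Geometry*, GTM 52, Ch. I, Prop. 1.13 (hypersurfaces have dimension `n - 1`);
  folklore.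
-/

-- single-problem summit: the doubled namespace component is forced
set_option linter.dupNamespace false

noncomputable section

namespace Summit.ResolutionOfSingularities.ResolutionOfSingularities.Theorems.FInjectiveMacaulayfication.HypersurfaceLocalDim

/-- **Heights drop by at least one modulo a non-zero element of a domain.** Let `S` be a domain,
`0 ≠ g ∈ S`, `Q` a prime ideal of `S/(g)` and `M = Q ∩ S` its pull-back. If `ht M ≤ m + 1` then
`ht Q ≤ m`: a chain `Q₀ < ⋯ < Q_r = Q` of primes of `S/(g)` pulls back to a chain `P₀ < ⋯ < P_r = M` of
primes of `S` containing `g ≠ 0`, so `(0) < P₀` extends it to a chain of length `r + 1` below `M`, whence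
`r + 1 ≤ m + 1`. [folklore] -/
theorem height_le_of_height_comap_le {S : Type*} [CommRing S] [IsDomain S] {g : S} (hg : g ≠ 0)
    (Q : Ideal (S ⧸ Ideal.span {g})) [Q.IsPrime] (m : ℕ)
    (hM : (Q.comap (Ideal.Quotient.mk (Ideal.span {g}))).height ≤ m + 1) : Q.height ≤ m := by
  -- the point `Q` of `Spec (S/(g))` and the pull-back map `Spec (S/(g)) → Spec S`
  let a : PrimeSpectrum (S ⧸ Ideal.span {g}) := ⟨Q, inferInstance⟩
  let f : PrimeSpectrum (S ⧸ Ideal.span {g}) → PrimeSpectrum S :=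
    fun P => ⟨P.asIdeal.comap (Ideal.Quotient.mk (Ideal.span {g})), inferInstance⟩
  have hf : StrictMono f := by
    intro P P' h
    rw [← PrimeSpectrum.asIdeal_lt_asIdeal] at h ⊢
    refine lt_of_le_of_ne (Ideal.comap_mono h.le) fun heq => h.ne ?_
    exact Ideal.comap_injective_of_surjective _ Ideal.Quotient.mk_surjective heq
  -- every pulled-back prime contains `g ≠ 0`, hence lies strictly above the generic point `(0)`
  have hbot : ∀ P : PrimeSpectrum (S ⧸ Ideal.span {g}), (⊥ : PrimeSpectrum S) < f P := by
    intro P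
    rw [← PrimeSpectrum.asIdeal_lt_asIdeal, PrimeSpectrum.asIdeal_bot]
    refine bot_lt_iff_ne_bot.mpr fun h => hg ?_
    have hgP : g ∈ (f P).asIdeal := by
      change Ideal.Quotient.mk (Ideal.span {g}) g ∈ P.asIdeal
      rw [Ideal.Quotient.eq_zero_iff_mem.mpr (Ideal.mem_span_singleton_self g)]
      exact P.asIdeal.zero_mem
    rw [h] at hgP
    exact (Submodule.mem_bot S).mp hgP
  -- translate ideal heights into order heights of points of the spectra
  have hQ : Q.height = Order.height a := PrimeSpectrum.height_eq_orderHeight a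
  have hfa : (Q.comap (Ideal.Quotient.mk (Ideal.span {g}))).height = Order.height (f a) :=
    PrimeSpectrum.height_eq_orderHeight (f a)
  rw [hQ]
  rw [hfa] at hM
  refine Order.height_le fun p hlast => ?_
  -- the extended chain `(0) < f p₀ < ⋯ < f p_r = f a`
  let q : LTSeries (PrimeSpectrum S) := (p.map f hf).cons ⊥ (by rw [LTSeries.head_map]; exact hbot _)
  have hlen : q.length = p.length + 1 := by
    simp only [q, RelSeries.cons_length, LTSeries.map_length]
  have hqlast : q.last = f a := by
    simp only [q, RelSeries.last_cons, LTSeries.last_map, hlast]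
  have h1 : (q.length : ℕ∞) ≤ Order.height q.last := Order.length_le_height_last
  rw [hlen, hqlast] at h1
  have h2 : ((p.length + 1 : ℕ) : ℕ∞) ≤ ((m + 1 : ℕ) : ℕ∞) := by
    refine h1.trans (hM.trans ?_)
    push_cast
    exact le_rfl
  have h3 : p.length + 1 ≤ m + 1 := by exact_mod_cast h2
  exact_mod_cast Nat.le_of_add_le_add_right h3

/-- **LOCAL DIMENSION OF AN AFFINE HYPERSURFACE** (registered stub `stub_hypersurfaceLocalDim` of crux
stmt-ResolutionOfSingularities-15315, skeleton 10f06f91): for a field `k`, `0 ≠ g ∈ k[X₀, …, Xₙ]` and a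
maximal ideal `Q` of `k[X₀, …, Xₙ]/(g)`, the local ring `(k[X₀, …, Xₙ]/(g))_Q` has Krull dimension `n`.
Proof: `dim = ht Q`; the pull-back `M` of `Q` is a maximal ideal of `k[X₀, …, Xₙ]` of height `n + 1`
containing `g`; `ht Q ≤ n` since chains below `Q` pull back to chains of primes containing `g ≠ 0`
(`height_le_of_height_comap_le`), and `ht Q ≥ n` by Krull's principal ideal theorem
`ht M ≤ ht (M/(g)) + 1` with `M/(g) = Q`. [folklore; Matsumura §5 Ex. 5.1, Thm. 13.5] -/
theorem stub_hypersurfaceLocalDim : ∀ (k : Type) [Field k] (n : ℕ) (g : MvPolynomial (Fin (n + 1)) k),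
    g ≠ 0 → ∀ (Q : Ideal (MvPolynomial (Fin (n + 1)) k ⧸ Ideal.span {g})) [Q.IsMaximal],
    ringKrullDim (Localization.AtPrime Q) = n := by
  intro k _ n g hg Q hQ
  -- the pull-back `M = Q ∩ k[X]`: maximal, contains `g`, of height `n + 1`
  haveI hM : (Q.comap (Ideal.Quotient.mk (Ideal.span {g}))).IsMaximal :=
    Ideal.comap_isMaximal_of_surjective _ Ideal.Quotient.mk_surjective
  have hgM : g ∈ Q.comap (Ideal.Quotient.mk (Ideal.span {g})) := by
    rw [Ideal.mem_comap, Ideal.Quotient.eq_zero_iff_mem.mpr (Ideal.mem_span_singleton_self g)]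
    exact Q.zero_mem
  have hMht : (Q.comap (Ideal.Quotient.mk (Ideal.span {g}))).height = (n : ℕ∞) + 1 := by
    rw [Literature.AlgebraicGeometry.Resolution.MvPolynomial.height_eq_of_isMaximal k (n + 1)
      (Q.comap (Ideal.Quotient.mk (Ideal.span {g}))), Nat.cast_add_one]
  -- `ht Q = n`
  have hQht : Q.height = n := by
    apply le_antisymm
    · exact height_le_of_height_comap_le hg Q n hMht.le
    · have h := Ideal.height_le_height_add_one_of_mem hgM
      rw [Ideal.map_comap_of_surjective _ Ideal.Quotient.mk_surjective, hMht] at h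
      exact (ENat.add_le_add_iff_right ENat.one_ne_top).mp h
  rw [IsLocalization.AtPrime.ringKrullDim_eq_height Q (Localization.AtPrime Q), hQht]
  norm_cast

end Summit.ResolutionOfSingularities.ResolutionOfSingularities.Theorems.FInjectiveMacaulayfication.HypersurfaceLocalDim

end
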